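import Literature.NumberTheory.LFunctions.SelbergArgOmegaKernel
import Literature.NumberTheory.LFunctions.TuringMethod
import HarnessLib

/-!
# Selberg's `Ω`-theorem for `S(t)`, step 2b: the convolution identity for the smoothed argument

Third file of the proof programme for the named fact
`Literature.NumberTheory.LFunctions.Selberg1946_zetaArgS_omega` (`SelbergArgOmega.lean`,
§ "Status of the discharge, and a proof programme"); it completes STEP 2 (the replacement of Tsang's
Lemma 5 / (3.3)–(3.6) by the explicit formula), building on `SelbergArgOmegaKernel.lean`
(the window `K_L`, the explicit formula at height `t`, the off-line antiderivative `𝒜_ρ`).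

K.-M. Tsang, *Some `Ω`-theorems for the Riemann zeta-function*, Acta Arith. 46 (1986), §3,
obtains `∫ S(t+u) V(u) du = W(t) + R(t) + O(log τ)` ((3.4)–(3.5)) by convolving `log ζ` with a
Fejér kernel. Here, with `S = zetaArgS = N - θ/π - 1` (Backlund's form, `RiemannSiegel.lean`) and the
non-negative window `K_L` of `SelbergArgOmegaKernel.lean`:

1. the explicit formula for `h_{L,t}` (`explicit_formula_testFn`) is integrated over `t ∈ [t₁, t₂]`;
   the sum over the zeros is integrated term by term (`integral_tsum_zeroSide`: dominated by
   `2 L e^{L/8} D₀ (1+t²) m(ρ)/(1+γ²)`, summable by `ZetaZeroSum.summable_zeroOrder_div_one_add_sq`),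
   and each term splits by the exact antiderivative of the kernel file into a window integral and an
   increment of `𝒜_ρ` (`tsum_zeroSide_integral_eq`): the off-line term is
   `ℛ_L(t) := ∑_ρ m(ρ) 𝒜_ρ(t)` (`offR`, absolutely convergent, `summable_norm_offA`);
2. the archimedean term integrates to `(1/π) ∫ K_L(v)(θ(v+t₂) - θ(v+t₁)) dv` (`integral_arch`: Fubini on
   `[t₁,t₂] × ℝ` against the majorant `(1+|v|)K_L(v)`, and `∫_{t₁}^{t₂} θ'(v+t) dt = θ(v+t₂) - θ(v+t₁)`,
   `hasDerivAt_riemannSiegelTheta_holds`), the prime term to `𝒱_L(t₂) - 𝒱_L(t₁)`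
   (`integral_primeTerm`), and the polar terms are `O((t₂-t₁) L e^{L/8}/(1 + L²t₁²))`
   (`norm_polarInt_le`): `integrated_explicit_formula`;
3. on the counting side the windows are moved from the zeros to the ordinates
   `γ_n = zetaOrdinate n` (`tsum_zeros_window_eq`, by the tree's dictionary
   `tsum_nontrivialZeros_eq_tsum_zetaOrdinate`); the reflected ordinates `-γ_n` contribute
   `O((t₂-t₁)L/(1+t₁²))` (`exists_tsum_window_neg_le`, from `(1+(γ+t)²)² ≥ (1+t₁²)(1+γ²)` and
   `∑_n 1/(1+γ_n²) < ∞`, `Montgomery.exists_density_le`), and the positive ordinates give EXACTLY the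
   increment of the smoothed counting function `Φ_N(t) = ∫ N(t+v) K_L(v) dv = ∑_n K̄_L(γ_n - t)`
   (`smoothN_eq_tsum`, monotone convergence with the tails `K̄_L(y) = ∫_{v>y} K_L`, `kerTail`;
   `tsum_intervalIntegral_kerDil_ordinate`);
4. `Φ_S = Φ_N - Φ_θ/π - 2π g₀(0)` (`smoothS_eq`; the crude bounds `N(x) ≤ B(1+x²)`,
   `exists_zetaZeroCount_le_sq`, and `|θ(x)| ≤ C(1+x²)`, `exists_abs_riemannSiegelTheta_le`, give the
   integrability), and the `θ`-terms cancel identically.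

## Main result

* `exists_smoothS_increment_bound` — there is an absolute `C > 0` with, for all `L ≥ 1` and
  `0 ≤ t₁ ≤ t₂`,
  `|Φ_S(t₂) - Φ_S(t₁) + (Re 𝒱_L(t₂) - Re 𝒱_L(t₁)) + (Re ℛ_L(t₂) - Re ℛ_L(t₁))| ≤ C L e^{L/8}(t₂ - t₁)/(1 + t₁²)`,
  `Φ_S(t) = ∫ S(t+v) K_L(v) dv` (`smoothS`). Thus on `[T, 2T]`: `Φ_S(t) = C_T - Re 𝒱_L(t) - Re ℛ_L(t) + O(L e^{L/8}/T)`,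
  which is Tsang's (3.4)–(3.5) with `W = -Re 𝒱_L` (a prime trigonometric polynomial of length
  `e^{L/4}`, whose moments are bounded in `SelbergArgOmegaPrimeMoments.lean`) and `R = -Re ℛ_L`.

What remains for `Selberg1946_zetaArgS_omega_holds` (programme steps 1, 3, 5): the `(2k+1)`-th moment
of `ℛ_L` on `[T, 2T]` from a zero-density estimate near `σ = 1/2` (`norm_offA_le` reduces it to counting
zeros off the line in windows of width `1/L`), the constant `C_T` (by averaging over `[T, 2T]`, Littlewood's
`∫ S = O(log T)`, `exists_abs_integral_zetaArgS_le`), the passage from `Φ_S` to `sup S` (`K_L ≥ 0`,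
`∫ K_L = 2π g₀(0)`, `S ≪ log t`), and Tsang's Lemma 4 (`Tsang1986_lemma4`) with `k ≍ (log T)^{2/3}/(log log T)²`.

## References

* [Tsang1986] K.-M. Tsang, *Some Ω-theorems for the Riemann zeta-function*, Acta Arith. 46
  (1986), 369–395, §3 (3.3)–(3.6), Lemma 5.
* A. Selberg, *Contributions to the theory of the Riemann zeta-function* (1946), §7.
* E. C. Titchmarsh, *The Theory of the Riemann Zeta-Function*, 2nd ed. (1986), §9.2 (density of
  ordinates), §9.9 (Littlewood's theorem).
-/

noncomputable section

open Complex Filter Set MeasureTheory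
open scoped Real Topology ComplexConjugate ArithmeticFunction.vonMangoldt

namespace Literature.NumberTheory.LFunctions

namespace SelbergOmega

open RudnickSarnakN

variable {L : ℝ}


section PartB

open ZetaZeros


/-- Uniform bound for the window transform at a zero: for `L ≥ 1`, `ρ` a non-trivial zero and real `t`,
`‖ĝ_L(ρ - it)‖ ≤ 2 L e^{L/8} D₀ (1 + t²)/(1 + (Im ρ)²)`. [folklore] -/
theorem norm_weilMellin_gDil_zero_le (hL : 1 ≤ L) (ρ : riemannZetaNontrivialZeros) (t : ℝ) :
    ‖weilMellin (gDil L) ((ρ : ℂ) - t * I)‖ ≤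
      2 * L * Real.exp (L / 8) * decayD0 * (1 + t ^ 2) / (1 + (ρ : ℂ).im ^ 2) := by
  have hL0 : 0 < L := by linarith
  have h := norm_weilMellin_gDil_le hL0 ((ρ : ℂ) - t * I)
  have hre : ((ρ : ℂ) - t * I).re = (ρ : ℂ).re := by simp
  have him : ((ρ : ℂ) - t * I).im = (ρ : ℂ).im - t := by simp
  rw [hre, him] at h
  have hβ : |(ρ : ℂ).re - 1 / 2| ≤ 1 / 2 := by
    rw [abs_le]
    constructor <;> linarith [riemannZetaNontrivialZeros.re_pos ρ.2, riemannZetaNontrivialZeros.re_lt_one ρ.2]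
  have hexp : Real.exp (L * |(ρ : ℂ).re - 1 / 2| / 4) ≤ Real.exp (L / 8) :=
    Real.exp_le_exp.2 (by nlinarith)
  have hden : 1 / (1 + (L * ((ρ : ℂ).im - t)) ^ 2) ≤ 2 * (1 + t ^ 2) / (1 + (ρ : ℂ).im ^ 2) := by
    have h1 : 1 / (1 + (L * ((ρ : ℂ).im - t)) ^ 2) ≤ 1 / (1 + (t - (ρ : ℂ).im) ^ 2) := by
      refine div_le_div_of_nonneg_left zero_le_one (by positivity) ?_
      have : (t - (ρ : ℂ).im) ^ 2 ≤ (L * ((ρ : ℂ).im - t)) ^ 2 := by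
        have e : (t - (ρ : ℂ).im) ^ 2 = ((ρ : ℂ).im - t) ^ 2 := by ring
        have hL2 : 1 ≤ L ^ 2 := by nlinarith
        rw [mul_pow, e]
        nlinarith [mul_le_mul_of_nonneg_right hL2 (sq_nonneg ((ρ : ℂ).im - t))]
      linarith
    exact h1.trans (OrdinateDictionary.one_div_one_add_sq_sub_le t _)
  have hD := decayD0_nonneg
  calc ‖weilMellin (gDil L) ((ρ : ℂ) - t * I)‖
      ≤ L * Real.exp (L * |(ρ : ℂ).re - 1 / 2| / 4) * decayD0 * (1 / (1 + (L * ((ρ : ℂ).im - t)) ^ 2)) := by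
        rw [mul_one_div]; exact h
    _ ≤ L * Real.exp (L / 8) * decayD0 * (2 * (1 + t ^ 2) / (1 + (ρ : ℂ).im ^ 2)) := by
        gcongr
    _ = _ := by ring

/-- Uniform bound for the off-line term at a zero: for `L ≥ 1`,
`‖𝒜_ρ(t)‖ ≤ L e^{L/8} D₀ (1 + t²)/(1 + (Im ρ)²)`. [folklore] -/
theorem norm_offA_zero_le (hL : 1 ≤ L) (ρ : riemannZetaNontrivialZeros) (t : ℝ) :
    ‖offA L (ρ : ℂ) t‖ ≤ L * Real.exp (L / 8) * decayD0 * (1 + t ^ 2) / (1 + (ρ : ℂ).im ^ 2) := by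
  have hL0 : 0 < L := by linarith
  have h := norm_offA_le hL0 (ρ : ℂ) t
  have hβ : |(ρ : ℂ).re - 1 / 2| ≤ 1 / 2 := by
    rw [abs_le]
    constructor <;> linarith [riemannZetaNontrivialZeros.re_pos ρ.2, riemannZetaNontrivialZeros.re_lt_one ρ.2]
  have hexp : Real.exp (L * |(ρ : ℂ).re - 1 / 2| / 4) ≤ Real.exp (L / 8) :=
    Real.exp_le_exp.2 (by nlinarith)
  have hden : 1 / (1 + (L * ((ρ : ℂ).im - t)) ^ 2) ≤ 2 * (1 + t ^ 2) / (1 + (ρ : ℂ).im ^ 2) := by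
    have h1 : 1 / (1 + (L * ((ρ : ℂ).im - t)) ^ 2) ≤ 1 / (1 + (t - (ρ : ℂ).im) ^ 2) := by
      refine div_le_div_of_nonneg_left zero_le_one (by positivity) ?_
      have : (t - (ρ : ℂ).im) ^ 2 ≤ (L * ((ρ : ℂ).im - t)) ^ 2 := by
        have e : (t - (ρ : ℂ).im) ^ 2 = ((ρ : ℂ).im - t) ^ 2 := by ring
        have hL2 : 1 ≤ L ^ 2 := by nlinarith
        rw [mul_pow, e]
        nlinarith [mul_le_mul_of_nonneg_right hL2 (sq_nonneg ((ρ : ℂ).im - t))]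
      linarith
    exact h1.trans (OrdinateDictionary.one_div_one_add_sq_sub_le t _)
  have hD := decayD0_nonneg
  calc ‖offA L (ρ : ℂ) t‖
      ≤ 1 / 2 * (L * Real.exp (L * |(ρ : ℂ).re - 1 / 2| / 4) * decayD0 *
          (1 / (1 + (L * ((ρ : ℂ).im - t)) ^ 2))) := by
        rw [mul_one_div]; exact h.trans (mul_le_mul_of_nonneg_right hβ (by positivity))
    _ ≤ 1 / 2 * (L * Real.exp (L / 8) * decayD0 * (2 * (1 + t ^ 2) / (1 + (ρ : ℂ).im ^ 2))) := by
        gcongr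
    _ = _ := by ring

/-- The off-line terms are absolutely summable over the zeros, for each `t`. [folklore] -/
theorem summable_norm_offA (hL : 1 ≤ L) (t : ℝ) :
    Summable fun ρ : riemannZetaNontrivialZeros ↦
      ‖(riemannZetaZeroOrder (ρ : ℂ) : ℂ) * offA L (ρ : ℂ) t‖ := by
  refine Summable.of_nonneg_of_le (fun ρ ↦ norm_nonneg _) (fun ρ ↦ ?_)
    (ZetaZeroSum.summable_zeroOrder_div_one_add_sq.mul_left (L * Real.exp (L / 8) * decayD0 * (1 + t ^ 2)))
  rw [norm_mul, Complex.norm_intCast, abs_of_nonneg (ZetaZeroSum.zeroOrder_nonneg ρ)]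
  calc (riemannZetaZeroOrder (ρ : ℂ) : ℝ) * ‖offA L (ρ : ℂ) t‖
      ≤ (riemannZetaZeroOrder (ρ : ℂ) : ℝ) * (L * Real.exp (L / 8) * decayD0 * (1 + t ^ 2) / (1 + (ρ : ℂ).im ^ 2)) :=
        mul_le_mul_of_nonneg_left (norm_offA_zero_le hL ρ t) (ZetaZeroSum.zeroOrder_nonneg ρ)
    _ = _ := by ring

/-- **The off-line term** `ℛ_L(t) := ∑_ρ m(ρ) 𝒜_ρ(t)` (absolutely convergent, `summable_norm_offA`);
only the zeros with `Re ρ ≠ 1/2` contribute. (Tsang 1986, (3.5): `R(t)`.) [cite: Tsang1986, (3.5)] -/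
def offR (L t : ℝ) : ℂ :=
  ∑' ρ : riemannZetaNontrivialZeros, (riemannZetaZeroOrder (ρ : ℂ) : ℂ) * offA L (ρ : ℂ) t

/-! ## Integrating the zero side over `[t₁, t₂]` -/

/-- **Term-by-term integration of the zero side**: for `L ≥ 1` and `t₁ ≤ t₂`,
`∫_{t₁}^{t₂} ∑_ρ m(ρ) ĝ_L(ρ - it) dt = ∑_ρ m(ρ) ∫_{t₁}^{t₂} ĝ_L(ρ - it) dt`. [folklore] -/
theorem integral_tsum_zeroSide (hL : 1 ≤ L) {t₁ t₂ : ℝ} (h12 : t₁ ≤ t₂) :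
    ∫ t in t₁..t₂, ∑' ρ : riemannZetaNontrivialZeros,
        (riemannZetaZeroOrder (ρ : ℂ) : ℂ) * weilMellin (gDil L) ((ρ : ℂ) - t * I) =
      ∑' ρ : riemannZetaNontrivialZeros, (riemannZetaZeroOrder (ρ : ℂ) : ℂ) *
        ∫ t in t₁..t₂, weilMellin (gDil L) ((ρ : ℂ) - t * I) := by
  have hL0 : 0 < L := by linarith
  simp_rw [← intervalIntegral.integral_const_mul, intervalIntegral.integral_of_le h12]
  set M : ℝ := max (t₁ ^ 2) (t₂ ^ 2) with hM
  set C : ℝ := 2 * L * Real.exp (L / 8) * decayD0 * (1 + M) * (t₂ - t₁) with hC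
  have hcont : ∀ ρ : riemannZetaNontrivialZeros, Continuous fun t : ℝ ↦
      (riemannZetaZeroOrder (ρ : ℂ) : ℂ) * weilMellin (gDil L) ((ρ : ℂ) - t * I) := fun ρ ↦
    continuous_const.mul ((continuous_weilMellin (continuous_gDil L) (gDil_isWeilTest hL0).2).comp
      (by fun_prop))
  have hF_int : ∀ ρ : riemannZetaNontrivialZeros, Integrable (fun t : ℝ ↦
      (riemannZetaZeroOrder (ρ : ℂ) : ℂ) * weilMellin (gDil L) ((ρ : ℂ) - t * I))
      (volume.restrict (Ioc t₁ t₂)) := fun ρ ↦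
    ((hcont ρ).integrableOn_Icc).mono_set Ioc_subset_Icc_self
  have hsq : ∀ t ∈ Ioc t₁ t₂, t ^ 2 ≤ M := by
    intro t ht
    rcases le_or_gt 0 t with h0 | h0
    · exact (pow_le_pow_left₀ h0 ht.2 2).trans (le_max_right _ _)
    · have : t ^ 2 ≤ t₁ ^ 2 := by nlinarith [ht.1]
      exact this.trans (le_max_left _ _)
  have hF_sum : Summable fun ρ : riemannZetaNontrivialZeros ↦ ∫ t in Ioc t₁ t₂,
      ‖(riemannZetaZeroOrder (ρ : ℂ) : ℂ) * weilMellin (gDil L) ((ρ : ℂ) - t * I)‖ := by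
    refine Summable.of_nonneg_of_le (fun ρ ↦ integral_nonneg fun t ↦ norm_nonneg _) (fun ρ ↦ ?_)
      (ZetaZeroSum.summable_zeroOrder_div_one_add_sq.mul_left C)
    have hm := ZetaZeroSum.zeroOrder_nonneg ρ
    have hbd : ∀ t ∈ Ioc t₁ t₂,
        ‖(riemannZetaZeroOrder (ρ : ℂ) : ℂ) * weilMellin (gDil L) ((ρ : ℂ) - t * I)‖ ≤
          2 * L * Real.exp (L / 8) * decayD0 * (1 + M) *
            ((riemannZetaZeroOrder (ρ : ℂ) : ℝ) / (1 + (ρ : ℂ).im ^ 2)) := by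
      intro t ht
      rw [norm_mul, Complex.norm_intCast, abs_of_nonneg hm]
      have h1 := norm_weilMellin_gDil_zero_le hL ρ t
      have hD := decayD0_nonneg
      calc (riemannZetaZeroOrder (ρ : ℂ) : ℝ) * ‖weilMellin (gDil L) ((ρ : ℂ) - t * I)‖
          ≤ (riemannZetaZeroOrder (ρ : ℂ) : ℝ) *
              (2 * L * Real.exp (L / 8) * decayD0 * (1 + M) / (1 + (ρ : ℂ).im ^ 2)) := by
            refine mul_le_mul_of_nonneg_left (h1.trans ?_) hm
            gcongr
            exact hsq t ht
        _ = _ := by ring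
    calc ∫ t in Ioc t₁ t₂, ‖(riemannZetaZeroOrder (ρ : ℂ) : ℂ) * weilMellin (gDil L) ((ρ : ℂ) - t * I)‖
        ≤ ∫ t in Ioc t₁ t₂, 2 * L * Real.exp (L / 8) * decayD0 * (1 + M) *
            ((riemannZetaZeroOrder (ρ : ℂ) : ℝ) / (1 + (ρ : ℂ).im ^ 2)) :=
          setIntegral_mono_on (hF_int ρ).norm
            ((continuous_const.integrableOn_Icc).mono_set Ioc_subset_Icc_self) measurableSet_Ioc hbd
      _ = C * ((riemannZetaZeroOrder (ρ : ℂ) : ℝ) / (1 + (ρ : ℂ).im ^ 2)) := by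
          rw [setIntegral_const]
          simp only [smul_eq_mul, Real.volume_real_Ioc_of_le h12, hC]
          ring
  exact (integral_tsum_of_summable_integral_norm hF_int hF_sum).symm

/-- Summability of `m(ρ) ∫_{t₁}^{t₂} K_L(Im ρ - t) dt` over the zeros. [folklore] -/
theorem summable_zeroOrder_mul_integral_kerDil (hL : 1 ≤ L) {t₁ t₂ : ℝ} (h12 : t₁ ≤ t₂) :
    Summable fun ρ : riemannZetaNontrivialZeros ↦
      ‖(riemannZetaZeroOrder (ρ : ℂ) : ℂ) * ((∫ t in t₁..t₂, kerDil L ((ρ : ℂ).im - t) : ℝ) : ℂ)‖ := by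
  have hL0 : 0 < L := by linarith
  obtain ⟨C, hC0, hC⟩ := exists_kerDil_le'
  set M : ℝ := max (t₁ ^ 2) (t₂ ^ 2) with hM
  have hsq : ∀ t ∈ Icc t₁ t₂, t ^ 2 ≤ M := by
    intro t ht
    rcases le_or_gt 0 t with h0 | h0
    · exact (pow_le_pow_left₀ h0 ht.2 2).trans (le_max_right _ _)
    · have : t ^ 2 ≤ t₁ ^ 2 := by nlinarith [ht.1]
      exact this.trans (le_max_left _ _)
  refine Summable.of_nonneg_of_le (fun ρ ↦ norm_nonneg _) (fun ρ ↦ ?_)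
    (ZetaZeroSum.summable_zeroOrder_div_one_add_sq.mul_left (L * C * (2 * (1 + M)) * (t₂ - t₁)))
  have hm := ZetaZeroSum.zeroOrder_nonneg ρ
  rw [norm_mul, Complex.norm_intCast, abs_of_nonneg hm, Complex.norm_real, Real.norm_eq_abs]
  have hbd : ∀ t ∈ Set.uIoc t₁ t₂, ‖kerDil L ((ρ : ℂ).im - t)‖ ≤
      L * C * (2 * (1 + M)) / (1 + (ρ : ℂ).im ^ 2) := by
    intro t ht
    rw [uIoc_of_le h12] at ht
    rw [Real.norm_of_nonneg (kerDil_nonneg hL0.le _)]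
    refine (hC L hL _).trans ?_
    have h2 : 1 / (1 + ((ρ : ℂ).im - t) ^ 2) ^ 2 ≤ 1 / (1 + (t - (ρ : ℂ).im) ^ 2) := by
      refine div_le_div_of_nonneg_left zero_le_one (by positivity) ?_
      have h0 : 0 ≤ (t - (ρ : ℂ).im) ^ 2 := sq_nonneg _
      nlinarith [sq_nonneg ((ρ : ℂ).im - t)]
    have h3 := OrdinateDictionary.one_div_one_add_sq_sub_le t (ρ : ℂ).im
    have h4 : 2 * (1 + t ^ 2) / (1 + (ρ : ℂ).im ^ 2) ≤ 2 * (1 + M) / (1 + (ρ : ℂ).im ^ 2) := by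
      gcongr; exact hsq t (Ioc_subset_Icc_self ht)
    calc L * C / (1 + ((ρ : ℂ).im - t) ^ 2) ^ 2 = L * C * (1 / (1 + ((ρ : ℂ).im - t) ^ 2) ^ 2) := by ring
      _ ≤ L * C * (2 * (1 + M) / (1 + (ρ : ℂ).im ^ 2)) :=
          mul_le_mul_of_nonneg_left (h2.trans (h3.trans h4)) (by positivity)
      _ = _ := by ring
  have hI := intervalIntegral.norm_integral_le_of_norm_le_const hbd
  rw [Real.norm_eq_abs, abs_of_nonneg (sub_nonneg.2 h12)] at hI
  calc (riemannZetaZeroOrder (ρ : ℂ) : ℝ) * |∫ t in t₁..t₂, kerDil L ((ρ : ℂ).im - t)|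
      ≤ (riemannZetaZeroOrder (ρ : ℂ) : ℝ) * (L * C * (2 * (1 + M)) / (1 + (ρ : ℂ).im ^ 2) * (t₂ - t₁)) :=
        mul_le_mul_of_nonneg_left hI hm
    _ = _ := by ring

/-- **The integrated zero side splits** into the window part and the off-line part: for `L ≥ 1`,
`t₁ ≤ t₂`,
`∑_ρ m(ρ) ∫_{t₁}^{t₂} ĝ_L(ρ - it) dt = ∑_ρ m(ρ) ∫_{t₁}^{t₂} K_L(Im ρ - t) dt + ℛ_L(t₂) - ℛ_L(t₁)`.
[folklore] -/
theorem tsum_zeroSide_integral_eq (hL : 1 ≤ L) {t₁ t₂ : ℝ} (h12 : t₁ ≤ t₂) :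
    ∑' ρ : riemannZetaNontrivialZeros, (riemannZetaZeroOrder (ρ : ℂ) : ℂ) *
        ∫ t in t₁..t₂, weilMellin (gDil L) ((ρ : ℂ) - t * I) =
      (∑' ρ : riemannZetaNontrivialZeros, (riemannZetaZeroOrder (ρ : ℂ) : ℂ) *
        ((∫ t in t₁..t₂, kerDil L ((ρ : ℂ).im - t) : ℝ) : ℂ)) + (offR L t₂ - offR L t₁) := by
  have hL0 : 0 < L := by linarith
  have hper : ∀ ρ : riemannZetaNontrivialZeros,
      (riemannZetaZeroOrder (ρ : ℂ) : ℂ) * ∫ t in t₁..t₂, weilMellin (gDil L) ((ρ : ℂ) - t * I) =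
      (riemannZetaZeroOrder (ρ : ℂ) : ℂ) * ((∫ t in t₁..t₂, kerDil L ((ρ : ℂ).im - t) : ℝ) : ℂ) +
        ((riemannZetaZeroOrder (ρ : ℂ) : ℂ) * offA L (ρ : ℂ) t₂ -
          (riemannZetaZeroOrder (ρ : ℂ) : ℂ) * offA L (ρ : ℂ) t₁) := by
    intro ρ
    have h := integral_weilMellin_sub_kerDil hL0 (ρ : ℂ) t₁ t₂
    have hc1 : Continuous fun t : ℝ ↦ weilMellin (gDil L) ((ρ : ℂ) - t * I) :=
      (continuous_weilMellin (continuous_gDil L) (gDil_isWeilTest hL0).2).comp (by fun_prop)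
    have hc2 : Continuous fun t : ℝ ↦ ((kerDil L ((ρ : ℂ).im - t) : ℝ) : ℂ) :=
      continuous_ofReal.comp ((continuous_kerDil L).comp (by fun_prop))
    rw [intervalIntegral.integral_sub (hc1.intervalIntegrable _ _) (hc2.intervalIntegrable _ _),
      intervalIntegral.integral_ofReal, sub_eq_iff_eq_add] at h
    rw [h]
    ring
  rw [tsum_congr hper]
  have hs1 := (summable_zeroOrder_mul_integral_kerDil hL h12).of_norm
  have hs2 := (summable_norm_offA hL t₂).of_norm
  have hs3 := (summable_norm_offA hL t₁).of_norm
  rw [hs1.tsum_add (hs2.sub hs3), hs2.tsum_sub hs3]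
  rfl

end PartB

/-! ## Integrating the archimedean term over `[t₁, t₂]` -/

section Arch

/-- `(1 + |v|) K_L(v)` is integrable (`K_L ≤ LC/(1+v²)²`). [folklore] -/
theorem integrable_one_add_abs_mul_kerDil (hL : 1 ≤ L) :
    Integrable fun v : ℝ ↦ (1 + |v|) * kerDil L v := by
  have hL0 : 0 < L := by linarith
  obtain ⟨C, hC0, hC⟩ := exists_kerDil_le'
  refine Integrable.mono' (integrable_inv_one_add_sq.const_mul (2 * L * C))
    (((continuous_const.add continuous_abs).mul (continuous_kerDil L)).aestronglyMeasurable)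
    (Eventually.of_forall fun v ↦ ?_)
  have hK := kerDil_nonneg hL0.le v
  rw [Real.norm_of_nonneg (by positivity)]
  have h1 : (1 + |v|) * kerDil L v ≤ (1 + |v|) * (L * C / (1 + v ^ 2) ^ 2) :=
    mul_le_mul_of_nonneg_left (hC L hL v) (by positivity)
  refine h1.trans ?_
  have hv : 1 + |v| ≤ 2 * (1 + v ^ 2) := by
    rcases le_or_gt 0 v with h | h
    · rw [abs_of_nonneg h]; nlinarith [sq_nonneg (v - 1)]
    · rw [abs_of_neg h]; nlinarith [sq_nonneg (v + 1)]
  have hpos : 0 < 1 + v ^ 2 := by positivity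
  have key : (1 + |v|) * (L * C / (1 + v ^ 2) ^ 2) ≤ 2 * (1 + v ^ 2) * (L * C / (1 + v ^ 2) ^ 2) :=
    mul_le_mul_of_nonneg_right hv (by positivity)
  refine key.trans (le_of_eq ?_)
  field_simp

/-- The smoothed `θ'` in translated form: `∫ K_L(u - t) θ'(u) du = ∫ K_L(v) θ'(v + t) dv`.
[folklore] -/
theorem integral_kerDil_mul_thetaDeriv_eq (L t : ℝ) :
    ∫ u : ℝ, kerDil L (u - t) * riemannSiegelThetaDeriv u =
      ∫ v : ℝ, kerDil L v * riemannSiegelThetaDeriv (v + t) := by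
  rw [← integral_add_right_eq_self (fun u : ℝ ↦ kerDil L (u - t) * riemannSiegelThetaDeriv u) t]
  simp

/-- Joint integrability of `(t, v) ↦ K_L(v) θ'(v + t)` on `uIoc t₁ t₂ × ℝ`. [folklore] -/
theorem integrable_kerDil_thetaDeriv_prod (hL : 1 ≤ L) (t₁ t₂ : ℝ) :
    Integrable (Function.uncurry fun (t v : ℝ) ↦ kerDil L v * riemannSiegelThetaDeriv (v + t))
      ((volume.restrict (Set.uIoc t₁ t₂)).prod volume) := by
  have hL0 : 0 < L := by linarith
  obtain ⟨Cθ, hCθ0, hCθ⟩ := exists_abs_riemannSiegelThetaDeriv_le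
  set M : ℝ := max |t₁| |t₂| with hM
  have hbd : ∀ t ∈ Set.uIoc t₁ t₂, |t| ≤ M := by
    intro t ht
    rcases Set.mem_uIoc.1 ht with ⟨h1, h2⟩ | ⟨h1, h2⟩
    · rw [abs_le]; constructor
      · linarith [neg_abs_le t₁, le_max_left |t₁| |t₂|]
      · linarith [le_abs_self t₂, le_max_right |t₁| |t₂|]
    · rw [abs_le]; constructor
      · linarith [neg_abs_le t₂, le_max_right |t₁| |t₂|]
      · linarith [le_abs_self t₁, le_max_left |t₁| |t₂|]
  have hfin : volume (Set.uIoc t₁ t₂) ≠ ⊤ := by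
    rw [Set.uIoc, Real.volume_Ioc]; exact ENNReal.ofReal_ne_top
  haveI : IsFiniteMeasure (volume.restrict (Set.uIoc t₁ t₂)) := isFiniteMeasure_restrict.2 hfin
  have hmaj : Integrable (fun p : ℝ × ℝ ↦ (1 : ℝ) * (Cθ * (1 + M) * ((1 + |p.2|) * kerDil L p.2)))
      ((volume.restrict (Set.uIoc t₁ t₂)).prod volume) :=
    (integrable_const (1 : ℝ)).mul_prod ((integrable_one_add_abs_mul_kerDil hL).const_mul _)
  refine hmaj.mono' ?_ ?_
  · exact (((continuous_kerDil L).comp continuous_snd).mul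
      (continuous_thetaDeriv.comp (continuous_snd.add continuous_fst))).aestronglyMeasurable
  · have h1 : ∀ᵐ z : ℝ × ℝ ∂((volume.restrict (Set.uIoc t₁ t₂)).prod volume), z.1 ∈ Set.uIoc t₁ t₂ :=
      (Measure.quasiMeasurePreserving_fst).ae (ae_restrict_mem measurableSet_uIoc)
    refine h1.mono fun z hz ↦ ?_
    obtain ⟨t, v⟩ := z
    simp only [Function.uncurry_apply_pair, one_mul] at hz ⊢
    rw [norm_mul, Real.norm_of_nonneg (kerDil_nonneg hL0.le _), Real.norm_eq_abs]
    have hθ : |riemannSiegelThetaDeriv (v + t)| ≤ Cθ * (1 + M) * (1 + |v|) := by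
      refine (hCθ _).trans ?_
      have : |v + t| ≤ |v| + M := (abs_add_le _ _).trans (by linarith [hbd t hz])
      have hM0 : 0 ≤ M := (abs_nonneg t₁).trans (le_max_left _ _)
      have h2 : 1 + |v + t| ≤ (1 + M) * (1 + |v|) := by nlinarith [abs_nonneg v]
      calc Cθ * (1 + |v + t|) ≤ Cθ * ((1 + M) * (1 + |v|)) := mul_le_mul_of_nonneg_left h2 hCθ0.le
        _ = _ := by ring
    have hK := kerDil_nonneg hL0.le v
    calc kerDil L v * |riemannSiegelThetaDeriv (v + t)|
        ≤ kerDil L v * (Cθ * (1 + M) * (1 + |v|)) := mul_le_mul_of_nonneg_left hθ hK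
      _ = Cθ * (1 + M) * ((1 + |v|) * kerDil L v) := by ring

/-- FTC for `θ` along a translate: `∫_{t₁}^{t₂} θ'(v + t) dt = θ(v + t₂) - θ(v + t₁)`. [folklore] -/
theorem integral_thetaDeriv_translate (v t₁ t₂ : ℝ) :
    ∫ t in t₁..t₂, riemannSiegelThetaDeriv (v + t) = riemannSiegelTheta (v + t₂) - riemannSiegelTheta (v + t₁) := by
  have hderiv : ∀ t ∈ uIcc t₁ t₂,
      HasDerivAt (fun t : ℝ ↦ riemannSiegelTheta (v + t)) (riemannSiegelThetaDeriv (v + t)) t :=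
    fun t _ ↦ HasDerivAt.comp_const_add v t (hasDerivAt_riemannSiegelTheta_holds (v + t))
  exact intervalIntegral.integral_eq_sub_of_hasDerivAt hderiv
    ((continuous_thetaDeriv.comp (by fun_prop)).intervalIntegrable _ _)

/-- **Integrating the archimedean term**: `t ↦ ∫ K_L(u - t)θ'(u) du` is integrable on `[t₁, t₂]` and
`∫_{t₁}^{t₂} (∫ K_L(u - t) θ'(u) du) dt = ∫ K_L(v) (θ(v + t₂) - θ(v + t₁)) dv`. [folklore] -/
theorem integral_arch (hL : 1 ≤ L) (t₁ t₂ : ℝ) :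
    IntervalIntegrable (fun t : ℝ ↦ ∫ u : ℝ, kerDil L (u - t) * riemannSiegelThetaDeriv u) volume t₁ t₂ ∧
    ∫ t in t₁..t₂, (∫ u : ℝ, kerDil L (u - t) * riemannSiegelThetaDeriv u) =
      ∫ v : ℝ, kerDil L v * (riemannSiegelTheta (v + t₂) - riemannSiegelTheta (v + t₁)) := by
  have hprod := integrable_kerDil_thetaDeriv_prod hL t₁ t₂
  simp_rw [integral_kerDil_mul_thetaDeriv_eq]
  refine ⟨?_, ?_⟩
  · rw [intervalIntegrable_iff]
    exact hprod.integral_prod_left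
  · rw [intervalIntegral_integral_swap hprod]
    refine integral_congr_ae (Eventually.of_forall fun v ↦ ?_)
    simp only
    rw [intervalIntegral.integral_const_mul, integral_thetaDeriv_translate]

end Arch

/-! ## The integrated explicit formula -/

section Integrated

open ZetaZeros

/-- The integrated polar terms `∫_{t₁}^{t₂} (ĝ_L(-it) + ĝ_L(1 - it)) dt`. [folklore] -/
def polarInt (L t₁ t₂ : ℝ) : ℂ :=
  ∫ t in t₁..t₂, (weilMellin (gDil L) (-(t * I)) + weilMellin (gDil L) (1 - t * I))

/-- **Polar terms are negligible**: for `0 ≤ t₁ ≤ t₂`,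
`‖∫_{t₁}^{t₂} (ĝ_L(-it) + ĝ_L(1-it)) dt‖ ≤ (t₂ - t₁) · 2 L e^{L/8} D₀/(1 + L² t₁²)`. [folklore] -/
theorem norm_polarInt_le (hL : 0 < L) {t₁ t₂ : ℝ} (h0 : 0 ≤ t₁) (h12 : t₁ ≤ t₂) :
    ‖polarInt L t₁ t₂‖ ≤ (t₂ - t₁) * (2 * L * Real.exp (L / 8) * decayD0 / (1 + (L * t₁) ^ 2)) := by
  have hbd : ∀ t ∈ Set.uIoc t₁ t₂, ‖weilMellin (gDil L) (-(t * I)) + weilMellin (gDil L) (1 - t * I)‖ ≤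
      2 * L * Real.exp (L / 8) * decayD0 / (1 + (L * t₁) ^ 2) := by
    intro t ht
    rw [uIoc_of_le h12] at ht
    obtain ⟨h1, h2⟩ := norm_polar_le hL t
    have ht1 : (L * t₁) ^ 2 ≤ (L * t) ^ 2 := by
      have : L * t₁ ≤ L * t := mul_le_mul_of_nonneg_left ht.1.le hL.le
      exact pow_le_pow_left₀ (by positivity) this 2
    have hD := decayD0_nonneg
    have hmono : L * Real.exp (L / 8) * decayD0 / (1 + (L * t) ^ 2) ≤
        L * Real.exp (L / 8) * decayD0 / (1 + (L * t₁) ^ 2) :=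
      div_le_div_of_nonneg_left (by positivity) (by positivity) (by linarith)
    calc _ ≤ ‖weilMellin (gDil L) (-(t * I))‖ + ‖weilMellin (gDil L) (1 - t * I)‖ := norm_add_le _ _
      _ ≤ 2 * (L * Real.exp (L / 8) * decayD0 / (1 + (L * t₁) ^ 2)) := by linarith [h1.trans hmono, h2.trans hmono]
      _ = _ := by ring
  have h := intervalIntegral.norm_integral_le_of_norm_le_const hbd
  rw [abs_of_nonneg (sub_nonneg.2 h12)] at h
  rw [polarInt]
  linarith

/-- **The explicit formula integrated over `[t₁, t₂]`** (`L ≥ 1`, `t₁ ≤ t₂`):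
`∑_ρ m(ρ) ∫_{t₁}^{t₂} K_L(Im ρ - t) dt + ℛ_L(t₂) - ℛ_L(t₁)`
`= ∫_{t₁}^{t₂}(polar) - (𝒱_L(t₂) - 𝒱_L(t₁)) + (1/π) ∫ K_L(v)(θ(v+t₂) - θ(v+t₁)) dv`.
[folklore] -/
theorem integrated_explicit_formula (hL : 1 ≤ L) {t₁ t₂ : ℝ} (h12 : t₁ ≤ t₂) :
    (∑' ρ : riemannZetaNontrivialZeros, (riemannZetaZeroOrder (ρ : ℂ) : ℂ) *
        ((∫ t in t₁..t₂, kerDil L ((ρ : ℂ).im - t) : ℝ) : ℂ)) + (offR L t₂ - offR L t₁) =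
      polarInt L t₁ t₂ - (primeV L t₂ - primeV L t₁) +
        (((1 / π) * ∫ v : ℝ, kerDil L v * (riemannSiegelTheta (v + t₂) - riemannSiegelTheta (v + t₁)) : ℝ) : ℂ) := by
  have hL0 : 0 < L := by linarith
  have key : ∀ t : ℝ, (∑' ρ : riemannZetaNontrivialZeros,
      (riemannZetaZeroOrder (ρ : ℂ) : ℂ) * weilMellin (gDil L) ((ρ : ℂ) - t * I)) =
      (weilMellin (gDil L) (-(t * I)) + weilMellin (gDil L) (1 - t * I)) - primeTerm L t +
        (((1 / π) * ∫ u : ℝ, kerDil L (u - t) * riemannSiegelThetaDeriv u : ℝ) : ℂ) := fun t ↦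
    explicit_formula_testFn hL0 t
  have hint := intervalIntegral.integral_congr (μ := volume) (a := t₁) (b := t₂) (fun t _ ↦ key t)
  rw [integral_tsum_zeroSide hL h12, tsum_zeroSide_integral_eq hL h12] at hint
  rw [hint]
  -- integrate the right-hand side term by term
  obtain ⟨hAi, hA⟩ := integral_arch hL t₁ t₂
  have hc1 : Continuous fun t : ℝ ↦ weilMellin (gDil L) (-(t * I)) + weilMellin (gDil L) (1 - t * I) :=
    ((continuous_weilMellin (continuous_gDil L) (gDil_isWeilTest hL0).2).comp (by fun_prop)).add
      ((continuous_weilMellin (continuous_gDil L) (gDil_isWeilTest hL0).2).comp (by fun_prop))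
  have hi1 := hc1.intervalIntegrable (μ := volume) t₁ t₂
  have hi2 := (continuous_primeTerm L).intervalIntegrable (μ := volume) t₁ t₂
  have hi3 : IntervalIntegrable (fun t : ℝ ↦
      (((1 / π) * ∫ u : ℝ, kerDil L (u - t) * riemannSiegelThetaDeriv u : ℝ) : ℂ)) volume t₁ t₂ := by
    have h := hAi.const_mul (1 / π)
    rw [intervalIntegrable_iff] at h ⊢
    exact h.ofReal
  rw [intervalIntegral.integral_add (hi1.sub hi2) hi3, intervalIntegral.integral_sub hi1 hi2,
    integral_primeTerm, intervalIntegral.integral_ofReal, intervalIntegral.integral_const_mul, hA]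
  rfl

end Integrated

/-! ## The counting side: `∑_n ∫_{t₁}^{t₂} K_L(γ_n - t) dt = Φ_N(t₂) - Φ_N(t₁)` -/

section Counting

/-- `N(x) = #{n : γ_n ≤ x}` as a sum of indicators over the enumeration of the ordinates
(`Montgomery.zetaOrdinate_le_iff_lt`: `γ_n ≤ x ↔ n < N(x)`). [folklore] -/
theorem zetaZeroCount_eq_tsum_indicator (x : ℝ) :
    (zetaZeroCount x : ℝ) = ∑' n : ℕ, if zetaOrdinate n ≤ x then (1 : ℝ) else 0 := by
  rw [tsum_eq_sum (s := Finset.range (zetaZeroCount x))]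
  · rw [Finset.sum_congr rfl (g := fun _ ↦ (1 : ℝ))]
    · simp
    · intro n hn
      rw [if_pos (Montgomery.zetaOrdinate_le_iff_lt.2 (Finset.mem_range.1 hn))]
  · intro n hn
    rw [if_neg]
    rwa [Montgomery.zetaOrdinate_le_iff_lt, ← Finset.mem_range]

/-- **A crude global bound for `N`**: `N(x) ≤ B (1 + x²)` for all real `x`, with
`B = ∑_n 1/(1 + γ_n²)` (each `γ_n ≤ x` contributes `≥ 1/(1+x²)` to that convergent sum). [folklore] -/
theorem exists_zetaZeroCount_le_sq : ∃ B : ℝ, 0 ≤ B ∧ ∀ x : ℝ, (zetaZeroCount x : ℝ) ≤ B * (1 + x ^ 2) := by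
  obtain ⟨A, hA0, hA⟩ := Montgomery.exists_density_le
  obtain ⟨hsum, hle⟩ := hA 0
  set B : ℝ := ∑' n : ℕ, 1 / (1 + (0 - zetaOrdinate n) ^ 2) with hB
  have hB0 : 0 ≤ B := tsum_nonneg fun n ↦ by positivity
  refine ⟨B, hB0, fun x ↦ ?_⟩
  rcases le_or_gt x 0 with hx | hx
  · rw [zetaZeroCount_eq_zero_of_nonpos hx]; simp; positivity
  · -- `N(x)/(1+x²) ≤ ∑_{n < N(x)} 1/(1+γ_n²) ≤ B`
    have hpos : 0 < 1 + x ^ 2 := by positivity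
    rw [← div_le_iff₀ hpos]
    have h1 : (zetaZeroCount x : ℝ) / (1 + x ^ 2) =
        ∑ n ∈ Finset.range (zetaZeroCount x), 1 / (1 + x ^ 2) := by
      simp [Finset.sum_const, div_eq_mul_inv]
    rw [h1]
    calc ∑ n ∈ Finset.range (zetaZeroCount x), 1 / (1 + x ^ 2)
        ≤ ∑ n ∈ Finset.range (zetaZeroCount x), 1 / (1 + (0 - zetaOrdinate n) ^ 2) := by
          refine Finset.sum_le_sum fun n hn ↦ ?_
          have hγx : zetaOrdinate n ≤ x := Montgomery.zetaOrdinate_le_iff_lt.2 (Finset.mem_range.1 hn)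
          have hγ0 : 0 < zetaOrdinate n := zetaOrdinate_pos_holds n
          refine div_le_div_of_nonneg_left zero_le_one (by positivity) ?_
          nlinarith
      _ ≤ B := hsum.sum_le_tsum _ fun n _ ↦ by positivity

/-- The tail mass of the window: `K̄_L(y) := ∫_{v > y} K_L(v) dv`. [folklore] -/
def kerTail (L y : ℝ) : ℝ := ∫ v in Set.Ioi y, kerDil L v

/-- `0 ≤ K̄_L(y)`. [folklore] -/
theorem kerTail_nonneg (hL : 0 ≤ L) (y : ℝ) : 0 ≤ kerTail L y :=
  setIntegral_nonneg measurableSet_Ioi fun v _ ↦ kerDil_nonneg hL v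

/-- `K̄_L(y) ≤ ∫ K_L = 2π g₀(0)`. [folklore] -/
theorem kerTail_le_integral (hL : 0 < L) (y : ℝ) : kerTail L y ≤ 2 * π * (g0 0).re := by
  rw [kerTail, ← integral_kerDil_real hL]
  exact setIntegral_le_integral (integrable_kerDil hL) (Eventually.of_forall fun v ↦ kerDil_nonneg hL.le v)

/-- Additivity of the tail: `K̄_L(a) = ∫_a^b K_L + K̄_L(b)` for `a ≤ b`. [folklore] -/
theorem kerTail_eq_intervalIntegral_add (hL : 0 < L) {a b : ℝ} (hab : a ≤ b) :
    kerTail L a = (∫ v in a..b, kerDil L v) + kerTail L b := by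
  rw [kerTail, kerTail, ← Set.Ioc_union_Ioi_eq_Ioi hab, setIntegral_union
    (Set.Ioc_disjoint_Ioi_same) measurableSet_Ioi
    ((integrable_kerDil hL).integrableOn) ((integrable_kerDil hL).integrableOn),
    intervalIntegral.integral_of_le hab]

/-- **Decay of the tail**: `K̄_L(y) ≤ π L C/(1 + y²)` for `y ≥ 0` (`L ≥ 1`; `C` of `exists_kerDil_le'`).
[folklore] -/
theorem exists_kerTail_le : ∃ C : ℝ, 0 < C ∧ ∀ L : ℝ, 1 ≤ L → ∀ y : ℝ, 0 ≤ y →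
    kerTail L y ≤ L * C / (1 + y ^ 2) := by
  obtain ⟨C, hC0, hC⟩ := exists_kerDil_le'
  refine ⟨π * C, by positivity, fun L hL y hy ↦ ?_⟩
  have hL0 : 0 < L := by linarith
  have hpos : 0 < 1 + y ^ 2 := by positivity
  have hbd : ∀ v ∈ Set.Ioi y, kerDil L v ≤ (L * C / (1 + y ^ 2)) * (1 + v ^ 2)⁻¹ := by
    intro v hv
    have hv : y < v := hv
    refine (hC L hL v).trans ?_
    have hyv : 1 + y ^ 2 ≤ 1 + v ^ 2 := by nlinarith
    have hpos' : 0 < 1 + v ^ 2 := by positivity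
    have e : (L * C / (1 + y ^ 2)) * (1 + v ^ 2)⁻¹ = L * C / ((1 + y ^ 2) * (1 + v ^ 2)) := by
      field_simp
    rw [e]
    refine div_le_div_of_nonneg_left (by positivity) (by positivity) ?_
    calc (1 + y ^ 2) * (1 + v ^ 2) ≤ (1 + v ^ 2) * (1 + v ^ 2) := mul_le_mul_of_nonneg_right hyv hpos'.le
      _ = (1 + v ^ 2) ^ 2 := by ring
  calc kerTail L y ≤ ∫ v in Set.Ioi y, (L * C / (1 + y ^ 2)) * (1 + v ^ 2)⁻¹ :=
        setIntegral_mono_on (integrable_kerDil hL0).integrableOn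
          ((integrable_inv_one_add_sq.const_mul _).integrableOn) measurableSet_Ioi hbd
    _ ≤ ∫ v, (L * C / (1 + y ^ 2)) * (1 + v ^ 2)⁻¹ :=
        setIntegral_le_integral (integrable_inv_one_add_sq.const_mul _)
          (Eventually.of_forall fun v ↦ by positivity)
    _ = L * (π * C) / (1 + y ^ 2) := by
        rw [integral_const_mul, integral_univ_inv_one_add_sq]; ring

/-- The tails `K̄_L(γ_n - t)` are summable over the ordinates (finitely many `γ_n ≤ t`, and
`K̄_L(γ_n - t) ≤ πLC/(1 + (γ_n - t)²)` beyond). [folklore] -/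
theorem summable_kerTail_ordinate (hL : 1 ≤ L) (t : ℝ) :
    Summable fun n : ℕ ↦ kerTail L (zetaOrdinate n - t) := by
  have hL0 : 0 < L := by linarith
  obtain ⟨C, hC0, hC⟩ := exists_kerTail_le
  obtain ⟨A, -, hA⟩ := Montgomery.exists_density_le
  obtain ⟨hsum, -⟩ := hA t
  classical
  -- majorant: indicator of the finitely many `n < N(t)` times `∫K`, plus the decaying tail bound
  set F : ℕ → ℝ := fun n ↦ (if n < zetaZeroCount t then 2 * π * (g0 0).re else 0) +
    L * C * (1 / (1 + (t - zetaOrdinate n) ^ 2)) with hF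
  have hFs : Summable F := by
    refine Summable.add ?_ (hsum.mul_left (L * C))
    refine summable_of_ne_finset_zero (s := Finset.range (zetaZeroCount t)) fun n hn ↦ ?_
    rw [if_neg (by rwa [Finset.mem_range] at hn)]
  refine Summable.of_nonneg_of_le (fun n ↦ kerTail_nonneg hL0.le _) (fun n ↦ ?_) hFs
  simp only [hF]
  by_cases hn : n < zetaZeroCount t
  · rw [if_pos hn]
    have h1 := kerTail_le_integral hL0 (zetaOrdinate n - t)
    have h2 : 0 ≤ L * C * (1 / (1 + (t - zetaOrdinate n) ^ 2)) := by positivity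
    linarith
  · rw [if_neg hn, zero_add]
    have hγ : t < zetaOrdinate n := Montgomery.lt_zetaOrdinate_iff.2 (not_lt.1 hn)
    have h := hC L hL (zetaOrdinate n - t) (by linarith)
    calc kerTail L (zetaOrdinate n - t) ≤ L * C / (1 + (zetaOrdinate n - t) ^ 2) := h
      _ = L * C * (1 / (1 + (t - zetaOrdinate n) ^ 2)) := by
          rw [show (zetaOrdinate n - t) ^ 2 = (t - zetaOrdinate n) ^ 2 by ring]; ring

/-- **The smoothed counting function** `Φ_N(t) := ∫ N(t + v) K_L(v) dv`. [folklore] -/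
def smoothN (L t : ℝ) : ℝ := ∫ v : ℝ, (zetaZeroCount (t + v) : ℝ) * kerDil L v

/-- `Φ_N(t) = ∑_n K̄_L(γ_n - t)`: each ordinate contributes the mass of the window beyond it
(monotone convergence: all terms are `≥ 0`). [folklore] -/
theorem smoothN_eq_tsum (hL : 1 ≤ L) (t : ℝ) :
    smoothN L t = ∑' n : ℕ, kerTail L (zetaOrdinate n - t) := by
  have hL0 : 0 < L := by linarith
  classical
  have hpt : ∀ v : ℝ, (zetaZeroCount (t + v) : ℝ) * kerDil L v =
      ∑' n : ℕ, (Set.Ici (zetaOrdinate n - t)).indicator (kerDil L) v := by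
    intro v
    rw [zetaZeroCount_eq_tsum_indicator, ← tsum_mul_right]
    refine tsum_congr fun n ↦ ?_
    by_cases h : zetaOrdinate n ≤ t + v
    · rw [if_pos h, one_mul, Set.indicator_of_mem (by simpa [sub_le_iff_le_add', add_comm] using h)]
    · rw [if_neg h, zero_mul, Set.indicator_of_notMem (by simpa [sub_le_iff_le_add', add_comm] using h)]
  unfold smoothN
  simp_rw [hpt]
  have hF_int : ∀ n : ℕ, Integrable ((Set.Ici (zetaOrdinate n - t)).indicator (kerDil L)) :=
    fun n ↦ (integrable_kerDil hL0).indicator measurableSet_Ici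
  have hnorm : ∀ n : ℕ, ∫ v, ‖(Set.Ici (zetaOrdinate n - t)).indicator (kerDil L) v‖ =
      kerTail L (zetaOrdinate n - t) := by
    intro n
    rw [kerTail, ← integral_Ici_eq_integral_Ioi, ← integral_indicator measurableSet_Ici]
    refine integral_congr_ae (Eventually.of_forall fun v ↦ ?_)
    simp only
    rw [Real.norm_eq_abs, abs_of_nonneg (Set.indicator_nonneg (fun _ _ ↦ kerDil_nonneg hL0.le _) _)]
  have hF_sum : Summable fun n : ℕ ↦ ∫ v, ‖(Set.Ici (zetaOrdinate n - t)).indicator (kerDil L) v‖ := by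
    simp_rw [hnorm]; exact summable_kerTail_ordinate hL t
  rw [← integral_tsum_of_summable_integral_norm hF_int hF_sum]
  refine tsum_congr fun n ↦ ?_
  rw [integral_indicator measurableSet_Ici, integral_Ici_eq_integral_Ioi, kerTail]

/-- The window mass swept between two heights: `∫_{t₁}^{t₂} K_L(γ - t) dt = K̄_L(γ - t₂) - K̄_L(γ - t₁)`
for `t₁ ≤ t₂`. [folklore] -/
theorem intervalIntegral_kerDil_sub_eq (hL : 0 < L) (γ : ℝ) {t₁ t₂ : ℝ} (h12 : t₁ ≤ t₂) :
    ∫ t in t₁..t₂, kerDil L (γ - t) = kerTail L (γ - t₂) - kerTail L (γ - t₁) := by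
  rw [intervalIntegral.integral_comp_sub_left (fun v ↦ kerDil L v) γ,
    kerTail_eq_intervalIntegral_add hL (show γ - t₂ ≤ γ - t₁ by linarith)]
  ring

/-- **The counting side of the integrated formula**: for `L ≥ 1`, `t₁ ≤ t₂`,
`∑_n ∫_{t₁}^{t₂} K_L(γ_n - t) dt = Φ_N(t₂) - Φ_N(t₁)`. [folklore] -/
theorem tsum_intervalIntegral_kerDil_ordinate (hL : 1 ≤ L) {t₁ t₂ : ℝ} (h12 : t₁ ≤ t₂) :
    ∑' n : ℕ, ∫ t in t₁..t₂, kerDil L (zetaOrdinate n - t) = smoothN L t₂ - smoothN L t₁ := by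
  have hL0 : 0 < L := by linarith
  simp_rw [intervalIntegral_kerDil_sub_eq hL0 _ h12]
  rw [(summable_kerTail_ordinate hL t₂).tsum_sub (summable_kerTail_ordinate hL t₁),
    smoothN_eq_tsum hL, smoothN_eq_tsum hL]

end Counting

/-! ## The window integrals at the ordinates -/

section Windows

open ZetaZeros

/-- The window kernel at bounded heights: for `L ≥ 1`, `t ∈ [t₁, t₂]` and real `y`,
`K_L(y - t) ≤ 2LC(1 + max(t₁², t₂²))/(1 + y²)`. [folklore] -/
theorem kerDil_sub_le_of_mem (hL : 1 ≤ L) {C : ℝ} (hC : ∀ L : ℝ, 1 ≤ L → ∀ r : ℝ, kerDil L r ≤ L * C / (1 + r ^ 2) ^ 2)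
    (hC0 : 0 < C) {t₁ t₂ t : ℝ} (ht : t ∈ Icc t₁ t₂) (y : ℝ) :
    kerDil L (y - t) ≤ 2 * L * C * (1 + max (t₁ ^ 2) (t₂ ^ 2)) / (1 + y ^ 2) := by
  have hL0 : 0 < L := by linarith
  have hsq : t ^ 2 ≤ max (t₁ ^ 2) (t₂ ^ 2) := by
    rcases le_or_gt 0 t with h0 | h0
    · exact (pow_le_pow_left₀ h0 ht.2 2).trans (le_max_right _ _)
    · have : t ^ 2 ≤ t₁ ^ 2 := by nlinarith [ht.1]
      exact this.trans (le_max_left _ _)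
  refine (hC L hL _).trans ?_
  have h2 : 1 / (1 + (y - t) ^ 2) ^ 2 ≤ 1 / (1 + (t - y) ^ 2) := by
    refine div_le_div_of_nonneg_left zero_le_one (by positivity) ?_
    have h0 : 0 ≤ (t - y) ^ 2 := sq_nonneg _
    nlinarith [sq_nonneg (y - t)]
  have h3 := OrdinateDictionary.one_div_one_add_sq_sub_le t y
  have h4 : 2 * (1 + t ^ 2) / (1 + y ^ 2) ≤ 2 * (1 + max (t₁ ^ 2) (t₂ ^ 2)) / (1 + y ^ 2) := by gcongr
  calc L * C / (1 + (y - t) ^ 2) ^ 2 = L * C * (1 / (1 + (y - t) ^ 2) ^ 2) := by ring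
    _ ≤ L * C * (2 * (1 + max (t₁ ^ 2) (t₂ ^ 2)) / (1 + y ^ 2)) :=
        mul_le_mul_of_nonneg_left (h2.trans (h3.trans h4)) (by positivity)
    _ = _ := by ring

/-- `0 ≤ ∫_{t₁}^{t₂} K_L(y - t) dt` for `t₁ ≤ t₂`. [folklore] -/
theorem intervalIntegral_kerDil_nonneg (hL : 0 ≤ L) (y : ℝ) {t₁ t₂ : ℝ} (h12 : t₁ ≤ t₂) :
    0 ≤ ∫ t in t₁..t₂, kerDil L (y - t) :=
  intervalIntegral.integral_nonneg h12 fun _ _ ↦ kerDil_nonneg hL _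

/-- The windows at the positive ordinates are summable. [folklore] -/
theorem summable_intervalIntegral_kerDil_ordinate (hL : 1 ≤ L) {t₁ t₂ : ℝ} (h12 : t₁ ≤ t₂) :
    Summable fun n : ℕ ↦ ∫ t in t₁..t₂, kerDil L (zetaOrdinate n - t) := by
  have hL0 : 0 < L := by linarith
  simp_rw [intervalIntegral_kerDil_sub_eq hL0 _ h12]
  exact (summable_kerTail_ordinate hL t₂).sub (summable_kerTail_ordinate hL t₁)

/-- **The windows at the reflected ordinates `-γ_n` are negligible**: there is `C > 0` such that
for `L ≥ 1` and `0 ≤ t₁ ≤ t₂` the family `n ↦ ∫_{t₁}^{t₂} K_L(-γ_n - t) dt` is summable and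
`0 ≤ ∑_n ∫_{t₁}^{t₂} K_L(-γ_n - t) dt ≤ C L (t₂ - t₁)/(1 + t₁²)`. [folklore] -/
theorem exists_tsum_window_neg_le : ∃ C : ℝ, 0 < C ∧ ∀ L : ℝ, 1 ≤ L → ∀ t₁ t₂ : ℝ, 0 ≤ t₁ → t₁ ≤ t₂ →
    Summable (fun n : ℕ ↦ ∫ t in t₁..t₂, kerDil L (-zetaOrdinate n - t)) ∧
    0 ≤ ∑' n : ℕ, ∫ t in t₁..t₂, kerDil L (-zetaOrdinate n - t) ∧
    ∑' n : ℕ, ∫ t in t₁..t₂, kerDil L (-zetaOrdinate n - t) ≤ C * L * (t₂ - t₁) / (1 + t₁ ^ 2) := by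
  obtain ⟨C, hC0, hC⟩ := exists_kerDil_le'
  obtain ⟨A, hA0, hA⟩ := Montgomery.exists_density_le
  obtain ⟨hsum0, hle0⟩ := hA 0
  set B : ℝ := ∑' n : ℕ, 1 / (1 + (0 - zetaOrdinate n) ^ 2) with hB
  have hB0 : 0 ≤ B := tsum_nonneg fun n ↦ by positivity
  have hBle : B ≤ A * Real.log 2 := by simpa using hle0
  refine ⟨C * (A * Real.log 2) + 1, by positivity, fun L hL t₁ t₂ h0 h12 ↦ ?_⟩
  have hL0 : 0 < L := by linarith
  -- termwise bound
  have hterm : ∀ n : ℕ, ∫ t in t₁..t₂, kerDil L (-zetaOrdinate n - t) ≤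
      (t₂ - t₁) * (L * C / (1 + t₁ ^ 2)) * (1 / (1 + (0 - zetaOrdinate n) ^ 2)) := by
    intro n
    have hγ : 0 < zetaOrdinate n := zetaOrdinate_pos_holds n
    have hbd : ∀ t ∈ Set.uIoc t₁ t₂, ‖kerDil L (-zetaOrdinate n - t)‖ ≤
        (L * C / (1 + t₁ ^ 2)) * (1 / (1 + (0 - zetaOrdinate n) ^ 2)) := by
      intro t ht
      rw [uIoc_of_le h12] at ht
      rw [Real.norm_of_nonneg (kerDil_nonneg hL0.le _)]
      refine (hC L hL _).trans ?_
      have ht0 : t₁ ≤ t := ht.1.le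
      have hkey : (1 + t₁ ^ 2) * (1 + zetaOrdinate n ^ 2) ≤ (1 + (-zetaOrdinate n - t) ^ 2) ^ 2 := by
        have e : (-zetaOrdinate n - t) ^ 2 = (zetaOrdinate n + t) ^ 2 := by ring
        rw [e]
        have h1 : (1 + t₁ ^ 2) * (1 + zetaOrdinate n ^ 2) ≤ (1 + t ^ 2) * (1 + zetaOrdinate n ^ 2) := by
          have : t₁ ^ 2 ≤ t ^ 2 := pow_le_pow_left₀ h0 ht0 2
          nlinarith [sq_nonneg (zetaOrdinate n)]
        refine h1.trans ?_
        have ht' : 0 ≤ t := h0.trans ht0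
        nlinarith [mul_nonneg ht' hγ.le, sq_nonneg t, sq_nonneg (zetaOrdinate n),
          mul_nonneg (mul_nonneg ht' hγ.le) (mul_nonneg ht' hγ.le), sq_nonneg (t * zetaOrdinate n),
          sq_nonneg (t - zetaOrdinate n)]
      rw [div_mul_div_comm, mul_one, show (0 - zetaOrdinate n) ^ 2 = zetaOrdinate n ^ 2 by ring]
      exact div_le_div_of_nonneg_left (by positivity) (by positivity) hkey
    have h := intervalIntegral.norm_integral_le_of_norm_le_const hbd
    rw [Real.norm_eq_abs, abs_of_nonneg (intervalIntegral_kerDil_nonneg hL0.le _ h12),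
      abs_of_nonneg (sub_nonneg.2 h12)] at h
    linarith
  have hmaj : Summable fun n : ℕ ↦ (t₂ - t₁) * (L * C / (1 + t₁ ^ 2)) * (1 / (1 + (0 - zetaOrdinate n) ^ 2)) :=
    hsum0.mul_left _
  have hs : Summable fun n : ℕ ↦ ∫ t in t₁..t₂, kerDil L (-zetaOrdinate n - t) :=
    Summable.of_nonneg_of_le (fun n ↦ intervalIntegral_kerDil_nonneg hL0.le _ h12) hterm hmaj
  refine ⟨hs, tsum_nonneg fun n ↦ intervalIntegral_kerDil_nonneg hL0.le _ h12, ?_⟩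
  calc ∑' n : ℕ, ∫ t in t₁..t₂, kerDil L (-zetaOrdinate n - t)
      ≤ ∑' n : ℕ, (t₂ - t₁) * (L * C / (1 + t₁ ^ 2)) * (1 / (1 + (0 - zetaOrdinate n) ^ 2)) :=
        hs.tsum_le_tsum hterm hmaj
    _ = (t₂ - t₁) * (L * C / (1 + t₁ ^ 2)) * B := by rw [tsum_mul_left]
    _ ≤ (t₂ - t₁) * (L * C / (1 + t₁ ^ 2)) * (A * Real.log 2) :=
        mul_le_mul_of_nonneg_left hBle (by
          have := sub_nonneg.2 h12
          positivity)
    _ ≤ (C * (A * Real.log 2) + 1) * L * (t₂ - t₁) / (1 + t₁ ^ 2) := by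
        have hpos : 0 < 1 + t₁ ^ 2 := by positivity
        have h12' := sub_nonneg.2 h12
        have e1 : (t₂ - t₁) * (L * C / (1 + t₁ ^ 2)) * (A * Real.log 2) =
            (C * (A * Real.log 2)) * (L * (t₂ - t₁) / (1 + t₁ ^ 2)) := by ring
        have e2 : (C * (A * Real.log 2) + 1) * L * (t₂ - t₁) / (1 + t₁ ^ 2) =
            (C * (A * Real.log 2) + 1) * (L * (t₂ - t₁) / (1 + t₁ ^ 2)) := by ring
        rw [e1, e2]
        exact mul_le_mul_of_nonneg_right (by linarith)
          (div_nonneg (mul_nonneg hL0.le h12') hpos.le)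

/-- **The zeros-to-ordinates dictionary for the windows**: for `L ≥ 1`, `0 ≤ t₁ ≤ t₂`,
`∑_ρ m(ρ) ∫_{t₁}^{t₂} K_L(Im ρ - t) dt = (Φ_N(t₂) - Φ_N(t₁)) + ∑_n ∫_{t₁}^{t₂} K_L(-γ_n - t) dt`.
[folklore] -/
theorem tsum_zeros_window_eq (hL : 1 ≤ L) {t₁ t₂ : ℝ} (h0 : 0 ≤ t₁) (h12 : t₁ ≤ t₂) :
    ∑' ρ : riemannZetaNontrivialZeros, (riemannZetaZeroOrder (ρ : ℂ) : ℂ) *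
        ((∫ t in t₁..t₂, kerDil L ((ρ : ℂ).im - t) : ℝ) : ℂ) =
      (((smoothN L t₂ - smoothN L t₁) + ∑' n : ℕ, ∫ t in t₁..t₂, kerDil L (-zetaOrdinate n - t) : ℝ) : ℂ) := by
  obtain ⟨C, hC0, hC⟩ := exists_tsum_window_neg_le
  obtain ⟨hsneg, -, -⟩ := hC L hL t₁ t₂ h0 h12
  have hspos := summable_intervalIntegral_kerDil_ordinate hL h12
  set F : ℝ → ℂ := fun y ↦ ((∫ t in t₁..t₂, kerDil L (y - t) : ℝ) : ℂ) with hF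
  have hA : Summable fun ρ : riemannZetaNontrivialZeros ↦ (riemannZetaZeroOrder (ρ : ℂ) : ℂ) * F (ρ : ℂ).im :=
    (summable_zeroOrder_mul_integral_kerDil hL h12).of_norm
  have hB : Summable fun n : ℕ ↦ F (zetaOrdinate n) + F (-zetaOrdinate n) := by
    simp only [hF]
    exact (Complex.summable_ofReal.2 hspos).add (Complex.summable_ofReal.2 hsneg)
  have h := tsum_nontrivialZeros_eq_tsum_zetaOrdinate F hA hB
  simp only [hF] at h
  rw [h, (Complex.summable_ofReal.2 hspos).tsum_add (Complex.summable_ofReal.2 hsneg),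
    ← Complex.ofReal_tsum, ← Complex.ofReal_tsum, tsum_intervalIntegral_kerDil_ordinate hL h12]
  push_cast
  ring

end Windows

/-! ## Smoothing `N`, `θ` and `S = N - θ/π - 1` by the window -/

section Smoothing

/-- `(1 + v²) K_L(v)` is integrable (`K_L ≤ LC/(1+v²)²`). [folklore] -/
theorem integrable_one_add_sq_mul_kerDil (hL : 1 ≤ L) :
    Integrable fun v : ℝ ↦ (1 + v ^ 2) * kerDil L v := by
  have hL0 : 0 < L := by linarith
  obtain ⟨C, hC0, hC⟩ := exists_kerDil_le'
  refine Integrable.mono' (integrable_inv_one_add_sq.const_mul (L * C))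
    (((continuous_const.add (continuous_pow 2)).mul (continuous_kerDil L)).aestronglyMeasurable)
    (Eventually.of_forall fun v ↦ ?_)
  have hK := kerDil_nonneg hL0.le v
  have hpos : 0 < 1 + v ^ 2 := by positivity
  rw [Real.norm_of_nonneg (by positivity)]
  calc (1 + v ^ 2) * kerDil L v ≤ (1 + v ^ 2) * (L * C / (1 + v ^ 2) ^ 2) :=
        mul_le_mul_of_nonneg_left (hC L hL v) hpos.le
    _ = L * C * (1 + v ^ 2)⁻¹ := by field_simp

/-- A global bound for `θ`: `|θ(x)| ≤ C (1 + x²)`. [folklore] -/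
theorem exists_abs_riemannSiegelTheta_le : ∃ C : ℝ, 0 < C ∧ ∀ x : ℝ, |riemannSiegelTheta x| ≤ C * (1 + x ^ 2) := by
  obtain ⟨C, hC0, hC⟩ := exists_abs_riemannSiegelThetaDeriv_le
  refine ⟨2 * C, by positivity, fun x ↦ ?_⟩
  have hbd : ∀ u ∈ Set.uIoc 0 x, ‖riemannSiegelThetaDeriv u‖ ≤ C * (1 + |x|) := by
    intro u hu
    rw [Real.norm_eq_abs]
    refine (hC u).trans (mul_le_mul_of_nonneg_left ?_ hC0.le)
    have : |u| ≤ |x| := by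
      rcases Set.mem_uIoc.1 hu with ⟨h1, h2⟩ | ⟨h1, h2⟩
      · rw [abs_of_pos h1]; exact h2.trans (le_abs_self x)
      · rw [abs_of_nonpos h2, abs_of_neg (by linarith)]; linarith
    linarith
  have h := intervalIntegral.norm_integral_le_of_norm_le_const hbd
  rw [sub_zero, Real.norm_eq_abs] at h
  have hx : |x| ≤ 1 + x ^ 2 := by
    rcases le_or_gt 0 x with h0 | h0
    · rw [abs_of_nonneg h0]; nlinarith [sq_nonneg (x - 1)]
    · rw [abs_of_neg h0]; nlinarith [sq_nonneg (x + 1)]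
  have hx2 : |x| * |x| = x ^ 2 := by rw [← abs_mul, ← pow_two, abs_of_nonneg (sq_nonneg x)]
  calc |riemannSiegelTheta x| = |∫ u in (0 : ℝ)..x, riemannSiegelThetaDeriv u| := rfl
    _ ≤ C * (1 + |x|) * |x| := h
    _ = C * (|x| + |x| * |x|) := by ring
    _ ≤ C * ((1 + x ^ 2) + x ^ 2) := by rw [hx2]; gcongr
    _ ≤ 2 * C * (1 + x ^ 2) := by nlinarith [sq_nonneg x]


/-- `v ↦ θ(t + v) K_L(v)` is integrable. [folklore] -/
theorem integrable_theta_mul_kerDil (hL : 1 ≤ L) (t : ℝ) :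
    Integrable fun v : ℝ ↦ riemannSiegelTheta (t + v) * kerDil L v := by
  have hL0 : 0 < L := by linarith
  obtain ⟨C, hC0, hC⟩ := exists_abs_riemannSiegelTheta_le
  refine Integrable.mono' ((integrable_one_add_sq_mul_kerDil hL).const_mul (2 * C * (1 + t ^ 2)))
    (((continuous_riemannSiegelTheta.comp (continuous_const.add continuous_id)).mul
      (continuous_kerDil L)).aestronglyMeasurable)
    (Eventually.of_forall fun v ↦ ?_)
  have hK := kerDil_nonneg hL0.le v
  rw [norm_mul, Real.norm_eq_abs, Real.norm_of_nonneg hK]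
  have h1 : |riemannSiegelTheta (t + v)| ≤ C * (2 * (1 + t ^ 2) * (1 + v ^ 2)) := by
    refine (hC _).trans (mul_le_mul_of_nonneg_left ?_ hC0.le)
    nlinarith [sq_nonneg (t - v), sq_nonneg (t * v), sq_nonneg t, sq_nonneg v]
  calc |riemannSiegelTheta (t + v)| * kerDil L v ≤ C * (2 * (1 + t ^ 2) * (1 + v ^ 2)) * kerDil L v :=
        mul_le_mul_of_nonneg_right h1 hK
    _ = 2 * C * (1 + t ^ 2) * ((1 + v ^ 2) * kerDil L v) := by ring

/-- `v ↦ N(t + v) K_L(v)` is integrable (`N(x) ≤ B(1 + x²)`, `N` monotone hence measurable).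
[folklore] -/
theorem integrable_count_mul_kerDil (hL : 1 ≤ L) (t : ℝ) :
    Integrable fun v : ℝ ↦ (zetaZeroCount (t + v) : ℝ) * kerDil L v := by
  have hL0 : 0 < L := by linarith
  obtain ⟨B, hB0, hB⟩ := exists_zetaZeroCount_le_sq
  have hmono : Monotone fun v : ℝ ↦ (zetaZeroCount (t + v) : ℝ) := fun a b hab ↦ by
    have h : zetaZeroCount (t + a) ≤ zetaZeroCount (t + b) := zetaZeroCount_mono (by linarith)
    show (zetaZeroCount (t + a) : ℝ) ≤ zetaZeroCount (t + b)
    exact_mod_cast h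
  refine Integrable.mono' ((integrable_one_add_sq_mul_kerDil hL).const_mul (2 * B * (1 + t ^ 2)))
    ((hmono.measurable.aestronglyMeasurable).mul (continuous_kerDil L).aestronglyMeasurable)
    (Eventually.of_forall fun v ↦ ?_)
  have hK := kerDil_nonneg hL0.le v
  rw [norm_mul, Real.norm_of_nonneg (Nat.cast_nonneg _), Real.norm_of_nonneg hK]
  have h1 : (zetaZeroCount (t + v) : ℝ) ≤ B * (2 * (1 + t ^ 2) * (1 + v ^ 2)) := by
    refine (hB _).trans (mul_le_mul_of_nonneg_left ?_ hB0)
    nlinarith [sq_nonneg (t - v), sq_nonneg (t * v), sq_nonneg t, sq_nonneg v]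
  calc (zetaZeroCount (t + v) : ℝ) * kerDil L v ≤ B * (2 * (1 + t ^ 2) * (1 + v ^ 2)) * kerDil L v :=
        mul_le_mul_of_nonneg_right h1 hK
    _ = 2 * B * (1 + t ^ 2) * ((1 + v ^ 2) * kerDil L v) := by ring

/-- **The smoothed theta function** `Φ_θ(t) := ∫ θ(t + v) K_L(v) dv`. [folklore] -/
def smoothTheta (L t : ℝ) : ℝ := ∫ v : ℝ, riemannSiegelTheta (t + v) * kerDil L v

/-- **The smoothed argument** `Φ_S(t) := ∫ S(t + v) K_L(v) dv`, `S = zetaArgS` (Backlund form,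
right-continuous). (Tsang 1986, (3.3)–(3.4): `∫ S(σ, t+u) V(u) du`.) [cite: Tsang1986, (3.3)–(3.4)] -/
def smoothS (L t : ℝ) : ℝ := ∫ v : ℝ, zetaArgS (t + v) * kerDil L v

/-- `v ↦ S(t + v) K_L(v)` is integrable. [folklore] -/
theorem integrable_zetaArgS_mul_kerDil (hL : 1 ≤ L) (t : ℝ) :
    Integrable fun v : ℝ ↦ zetaArgS (t + v) * kerDil L v := by
  have hL0 : 0 < L := by linarith
  have h := ((integrable_count_mul_kerDil hL t).sub ((integrable_theta_mul_kerDil hL t).div_const π)).sub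
    (integrable_kerDil hL0)
  refine h.congr (Eventually.of_forall fun v ↦ ?_)
  simp only [zetaArgS, Pi.sub_apply]
  ring

/-- `Φ_S = Φ_N - Φ_θ/π - 2π g₀(0)`. [folklore] -/
theorem smoothS_eq (hL : 1 ≤ L) (t : ℝ) :
    smoothS L t = smoothN L t - smoothTheta L t / π - 2 * π * (g0 0).re := by
  have hL0 : 0 < L := by linarith
  have e : ∀ v : ℝ, zetaArgS (t + v) * kerDil L v =
      ((zetaZeroCount (t + v) : ℝ) * kerDil L v - riemannSiegelTheta (t + v) * kerDil L v / π) -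
        kerDil L v := by
    intro v; simp only [zetaArgS]; ring
  unfold smoothS smoothN smoothTheta
  simp_rw [e]
  have h1 : Integrable fun v : ℝ ↦ (zetaZeroCount (t + v) : ℝ) * kerDil L v -
      riemannSiegelTheta (t + v) * kerDil L v / π :=
    (integrable_count_mul_kerDil hL t).sub ((integrable_theta_mul_kerDil hL t).div_const π)
  have h2 : Integrable fun v : ℝ ↦ riemannSiegelTheta (t + v) * kerDil L v / π :=
    (integrable_theta_mul_kerDil hL t).div_const π
  rw [integral_sub h1 (integrable_kerDil hL0), integral_sub (integrable_count_mul_kerDil hL t) h2,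
    integral_div, integral_kerDil_real hL0]

/-- The `θ`-part of the integrated archimedean term is a difference of `Φ_θ`:
`∫ K_L(v)(θ(v + t₂) - θ(v + t₁)) dv = Φ_θ(t₂) - Φ_θ(t₁)`. [folklore] -/
theorem integral_kerDil_mul_theta_sub (hL : 1 ≤ L) (t₁ t₂ : ℝ) :
    ∫ v : ℝ, kerDil L v * (riemannSiegelTheta (v + t₂) - riemannSiegelTheta (v + t₁)) =
      smoothTheta L t₂ - smoothTheta L t₁ := by
  unfold smoothTheta
  rw [← integral_sub (integrable_theta_mul_kerDil hL t₂) (integrable_theta_mul_kerDil hL t₁)]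
  refine integral_congr_ae (Eventually.of_forall fun v ↦ ?_)
  simp only
  rw [add_comm v t₂, add_comm v t₁]
  ring

end Smoothing

/-! ## The convolution identity for `S` -/

section Identity

open ZetaZeros

/-- **The convolution identity (Tsang (3.4)–(3.6), unconditional form).** There is an absolute
constant `C > 0` such that for every `L ≥ 1` and all `0 ≤ t₁ ≤ t₂`,

  `|Φ_S(t₂) - Φ_S(t₁) + (Re 𝒱_L(t₂) - Re 𝒱_L(t₁)) + (Re ℛ_L(t₂) - Re ℛ_L(t₁))| ≤ C L e^{L/8} (t₂ - t₁)/(1 + t₁²)`,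

where `Φ_S(t) = ∫ S(t+v) K_L(v) dv` is the argument of `ζ` smoothed by the non-negative window
`K_L` of mass `2π g₀(0)`, `𝒱_L` is the prime trigonometric polynomial `primeV` (length `e^{L/4}`)
and `ℛ_L = offR` the off-line zero term. In words: on any height range `[T, 2T]` the smoothed
argument equals `-Re 𝒱_L(t) - Re ℛ_L(t)` up to an additive constant and an error `O(L e^{L/8}/T)`.
The error consists of the polar terms of the explicit formula (`norm_polarInt_le`) and of the
windows at the reflected ordinates `-γ_n` (`exists_tsum_window_neg_le`). [cite: Tsang1986, §3 (3.4)–(3.6)] -/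
theorem exists_smoothS_increment_bound : ∃ C : ℝ, 0 < C ∧ ∀ L : ℝ, 1 ≤ L → ∀ t₁ t₂ : ℝ, 0 ≤ t₁ → t₁ ≤ t₂ →
    |(smoothS L t₂ - smoothS L t₁) + ((primeV L t₂).re - (primeV L t₁).re) +
        ((offR L t₂).re - (offR L t₁).re)| ≤ C * L * Real.exp (L / 8) * (t₂ - t₁) / (1 + t₁ ^ 2) := by
  obtain ⟨Cn, hCn0, hCn⟩ := exists_tsum_window_neg_le
  refine ⟨2 * decayD0 + Cn, by positivity [decayD0_nonneg], fun L hL t₁ t₂ h0 h12 ↦ ?_⟩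
  have hL0 : 0 < L := by linarith
  obtain ⟨-, hneg0, hneg⟩ := hCn L hL t₁ t₂ h0 h12
  set Sneg : ℝ := ∑' n : ℕ, ∫ t in t₁..t₂, kerDil L (-zetaOrdinate n - t) with hSneg
  -- real part of the integrated explicit formula
  have hmain := integrated_explicit_formula hL h12
  rw [tsum_zeros_window_eq hL h0 h12] at hmain
  have hre := congrArg Complex.re hmain
  simp only [Complex.add_re, Complex.sub_re, Complex.ofReal_re] at hre
  rw [integral_kerDil_mul_theta_sub hL] at hre
  -- `Φ_S` increments
  have hS : smoothS L t₂ - smoothS L t₁ =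
      (smoothN L t₂ - smoothN L t₁) - (smoothTheta L t₂ - smoothTheta L t₁) / π := by
    rw [smoothS_eq hL, smoothS_eq hL]; ring
  have hE : (smoothS L t₂ - smoothS L t₁) + ((primeV L t₂).re - (primeV L t₁).re) +
      ((offR L t₂).re - (offR L t₁).re) = (polarInt L t₁ t₂).re - Sneg := by
    rw [hS]
    have hπ : (π : ℝ) ≠ 0 := Real.pi_ne_zero
    have e : (1 / π * (smoothTheta L t₂ - smoothTheta L t₁) : ℝ) = (smoothTheta L t₂ - smoothTheta L t₁) / π := by
      ring
    linarith [hre, e]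
  rw [hE]
  -- bounds
  have hpol := norm_polarInt_le hL0 h0 h12
  have hre_le : |(polarInt L t₁ t₂).re| ≤ ‖polarInt L t₁ t₂‖ := Complex.abs_re_le_norm _
  have hden : 1 + t₁ ^ 2 ≤ 1 + (L * t₁) ^ 2 := by
    have hL2 : 1 ≤ L ^ 2 := by nlinarith
    rw [mul_pow]; nlinarith [mul_le_mul_of_nonneg_right hL2 (sq_nonneg t₁)]
  have hD := decayD0_nonneg
  have h12' := sub_nonneg.2 h12
  have hexp : 1 ≤ Real.exp (L / 8) := Real.one_le_exp (by positivity)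
  have hpol' : ‖polarInt L t₁ t₂‖ ≤ (t₂ - t₁) * (2 * L * Real.exp (L / 8) * decayD0 / (1 + t₁ ^ 2)) := by
    refine hpol.trans (mul_le_mul_of_nonneg_left ?_ h12')
    exact div_le_div_of_nonneg_left (by positivity) (by positivity) hden
  have hneg' : Sneg ≤ Cn * L * Real.exp (L / 8) * (t₂ - t₁) / (1 + t₁ ^ 2) := by
    refine hneg.trans ?_
    have hpos : 0 < 1 + t₁ ^ 2 := by positivity
    rw [div_le_div_iff_of_pos_right hpos]
    have : Cn * L * (t₂ - t₁) * 1 ≤ Cn * L * (t₂ - t₁) * Real.exp (L / 8) :=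
      mul_le_mul_of_nonneg_left hexp (by positivity)
    linarith
  calc |(polarInt L t₁ t₂).re - Sneg| ≤ |(polarInt L t₁ t₂).re| + |Sneg| := abs_sub _ _
    _ ≤ ‖polarInt L t₁ t₂‖ + Sneg := by rw [abs_of_nonneg hneg0]; linarith
    _ ≤ (t₂ - t₁) * (2 * L * Real.exp (L / 8) * decayD0 / (1 + t₁ ^ 2)) +
          Cn * L * Real.exp (L / 8) * (t₂ - t₁) / (1 + t₁ ^ 2) := add_le_add hpol' hneg'
    _ = (2 * decayD0 + Cn) * L * Real.exp (L / 8) * (t₂ - t₁) / (1 + t₁ ^ 2) := by ring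

end Identity

end SelbergOmega

end Literature.NumberTheory.LFunctions

end
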